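/-
Copyright (c) 2026 the pub-hodgecm-mathlib formalisation cell (harness21).  Prover seat hodgecm-mathlib-LH7-p04 (g11), 2026-09-03.
Road M6 → F3 «TOT-Λ BY OVER-ORDERS» (WORD #69∕#75∕#77 by name; F3-5 pen by (α)), brick F3-5∕(S7b) «THE LAW'S `H` FROM F3-1b».
-/
import Literature.NumberTheory.Automorphic.GluedOverOrdersCount   -- ★ F3-1b (this seat) p852927: the master count, (C1) `natCard_hermitianChars_odd`, (C2) `_even`, (C3) `natCard_quotient_span_pow_zero`
import HarnessLib

/-!
# The over-order law's level function `H(N″, b)`: F3-1b's counts in F3-4's hypothesis shape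

Topic `NumberTheory/Automorphic`; namespace `Literature.NumberTheory.Automorphic`.  THEOREMS ONLY (no definition, no instance, no notation, no named fact, no `sorry`).
Cell `pub/hodgecm-mathlib` (D-0151), crux H413 = `stmt-HodgeConjecture-24833`; road M6 → F3, sigsheet F3-5 v1 (6925585c) step (S7): F3-4 `OverOrderLawClosedForms` (F0P3a-p04 (g30))
takes the level function `H : ℕ → ℕ → ℕ` ABSTRACTLY with three value hypotheses `hH0 ∕ hHodd ∕ hHeven`; F3-5 instantiates
`H N″ b := #{w ∈ 𝒪_F ⧸ ϖ^b | ∃ y ↦ w, Lvl(N″, b, y) ∧ ϖ^{N−N″}·y ≡ c (mod ϖ^b)}` — the number of HERMITIAN (`y ∈ 𝒪_F`), COMPATIBLE (`ϖ^{N−N″} y ≡ c`) character values at a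
MONOGENIC LEVEL (`Lvl`, ★ F3-3's `hlvl` disjunction with the `b = 0` boundary added) — and this file discharges the three hypotheses from ★ F3-1b, with the valuation `m` of the
type-(2) order's character value `c` entering through `hm : ∀ j, c ∈ (ϖ^j) ↔ j ≤ m`.  HONEST LABEL: HC_CM is proved only modulo the 2 remaining named inputs (hLiu418 24832,
h413 24833) until rung 0 closes; DVR counting only, asserts nothing printed; count-neutral.

* `natCard_levelChars_zero` (`hH0`: one class at `b = 0`), `natCard_levelChars_odd` (`hHodd`), `natCard_levelChars_even` (`hHeven`).

## References
* [Neukirch1999] J. Neukirch, *Algebraic Number Theory*, Grundlehren 322 (1999): Ch. I §12 (orders of conductor `f`, counting residue classes).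
* [SerreLocalFields1979] J.-P. Serre, *Local Fields*, GTM 67 (1979): Ch. IV §1 (the filtration `(π^n)`).
* [Flicker1998UnitaryFL] Y. Z. Flicker, *Elementary proof of the fundamental lemma for a unitary group*, Canad. J. Math. 50 (1998): Props. 7, 11, 16–17 (the closed forms the law sums to).
-/

set_option autoImplicit false

open scoped ValuativeRel

namespace Literature.NumberTheory.Automorphic

variable {F : Type*} [Field F] [ValuativeRel F] {ϖ : F} (hϖ : IsUniformizingElement ϖ)

include hϖ in
/-- **`hH0`: at the boundary level `b = 0` there is exactly one class** (`𝒪 ⧸ (ϖ^0)` is a point; `Lvl(N″, 0, ·)` holds by its first disjunct). [cite: Neukirch1999, Ch. I §12] -/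
theorem natCard_levelChars_zero (N N'' : ℕ) (c : 𝒪[F]) :
    Nat.card {w : 𝒪[F] ⧸ Ideal.span ({(⟨ϖ, hϖ.mem⟩ : 𝒪[F]) ^ 0} : Set 𝒪[F]) //
        ∃ y : 𝒪[F], Ideal.Quotient.mk _ y = w ∧
          ((0 : ℕ) = 0 ∨ ((0 : ℕ) = 2 * N'' + 1 ∧ y ∈ Ideal.span ({(⟨ϖ, hϖ.mem⟩ : 𝒪[F]) ^ (N'' + 1)} : Set 𝒪[F])) ∨
            ∃ M : ℕ, 1 ≤ M ∧ M ≤ N'' ∧ (0 : ℕ) = 2 * M ∧ y ∈ Ideal.span ({(⟨ϖ, hϖ.mem⟩ : 𝒪[F]) ^ M} : Set 𝒪[F]) ∧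
              y ∉ Ideal.span ({(⟨ϖ, hϖ.mem⟩ : 𝒪[F]) ^ (M + 1)} : Set 𝒪[F])) ∧
          (⟨ϖ, hϖ.mem⟩ : 𝒪[F]) ^ (N - N'') * y - c ∈ Ideal.span ({(⟨ϖ, hϖ.mem⟩ : 𝒪[F]) ^ 0} : Set 𝒪[F])} = 1 := by
  rw [← natCard_quotient_span_pow_zero hϖ]
  refine Nat.card_congr (Equiv.subtypeUnivEquiv fun w => ?_)
  obtain ⟨y, rfl⟩ := Ideal.Quotient.mk_surjective w
  refine ⟨y, rfl, Or.inl rfl, ?_⟩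
  rw [pow_zero, Ideal.span_singleton_one]
  exact Submodule.mem_top

include hϖ in
/-- **`hHodd`: at an odd level `b`** the monogenic-level classes exist only for `b = 2N″ + 1` (character values `y ∈ (ϖ^{N″+1})`), and then ★ F3-1b (C1) counts the compatible ones:
`q^{min(N″, N−N″)}` if `min(b, N+1) ≤ m = ord c`, else `0`. [cite: Neukirch1999, Ch. I §12] [cite: SerreLocalFields1979, Ch. IV §1] -/
theorem natCard_levelChars_odd [Finite 𝓀[F]] [IsDiscreteValuationRing 𝒪[F]] {N N'' : ℕ} (hN : N'' ≤ N) {b : ℕ} (hb : b % 2 = 1) (c : 𝒪[F])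
    {m : ℕ} (hm : ∀ j : ℕ, c ∈ Ideal.span ({(⟨ϖ, hϖ.mem⟩ : 𝒪[F]) ^ j} : Set 𝒪[F]) ↔ j ≤ m) :
    Nat.card {w : 𝒪[F] ⧸ Ideal.span ({(⟨ϖ, hϖ.mem⟩ : 𝒪[F]) ^ b} : Set 𝒪[F]) //
        ∃ y : 𝒪[F], Ideal.Quotient.mk _ y = w ∧
          (b = 0 ∨ (b = 2 * N'' + 1 ∧ y ∈ Ideal.span ({(⟨ϖ, hϖ.mem⟩ : 𝒪[F]) ^ (N'' + 1)} : Set 𝒪[F])) ∨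
            ∃ M : ℕ, 1 ≤ M ∧ M ≤ N'' ∧ b = 2 * M ∧ y ∈ Ideal.span ({(⟨ϖ, hϖ.mem⟩ : 𝒪[F]) ^ M} : Set 𝒪[F]) ∧
              y ∉ Ideal.span ({(⟨ϖ, hϖ.mem⟩ : 𝒪[F]) ^ (M + 1)} : Set 𝒪[F])) ∧
          (⟨ϖ, hϖ.mem⟩ : 𝒪[F]) ^ (N - N'') * y - c ∈ Ideal.span ({(⟨ϖ, hϖ.mem⟩ : 𝒪[F]) ^ b} : Set 𝒪[F])} =
      if b = 2 * N'' + 1 ∧ min b (N + 1) ≤ m then Nat.card 𝓀[F] ^ min N'' (N - N'') else 0 := by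
  classical
  by_cases hb' : b = 2 * N'' + 1
  · subst hb'
    -- the level predicate collapses to `y ∈ (ϖ^{N″+1})`
    rw [Nat.card_congr (Equiv.subtypeEquivRight (fun w => _) :
        _ ≃ {w : 𝒪[F] ⧸ Ideal.span ({(⟨ϖ, hϖ.mem⟩ : 𝒪[F]) ^ (2 * N'' + 1)} : Set 𝒪[F]) //
          ∃ y : 𝒪[F], Ideal.Quotient.mk _ y = w ∧ y ∈ Ideal.span ({(⟨ϖ, hϖ.mem⟩ : 𝒪[F]) ^ (N'' + 1)} : Set 𝒪[F]) ∧
            (⟨ϖ, hϖ.mem⟩ : 𝒪[F]) ^ (N - N'') * y - c ∈ Ideal.span ({(⟨ϖ, hϖ.mem⟩ : 𝒪[F]) ^ (2 * N'' + 1)} : Set 𝒪[F])}),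
      natCard_hermitianChars_odd hϖ hN c]
    · by_cases hc : min (2 * N'' + 1) (N + 1) ≤ m
      · rw [if_pos ((hm _).2 hc), if_pos (show 2 * N'' + 1 = 2 * N'' + 1 ∧ min (2 * N'' + 1) (N + 1) ≤ m from ⟨rfl, hc⟩)]
      · rw [if_neg (show c ∉ Ideal.span ({(⟨ϖ, hϖ.mem⟩ : 𝒪[F]) ^ min (2 * N'' + 1) (N + 1)} : Set 𝒪[F]) from fun h => hc ((hm _).1 h)),
          if_neg (show ¬ (2 * N'' + 1 = 2 * N'' + 1 ∧ min (2 * N'' + 1) (N + 1) ≤ m) from fun h => hc h.2)]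
    · intro w
      refine exists_congr fun y => and_congr_right fun _ => ⟨fun h => ⟨?_, h.2⟩, fun h => ⟨Or.inr (Or.inl ⟨rfl, h.1⟩), h.2⟩⟩
      rcases h.1 with h0 | ⟨-, hy⟩ | ⟨M, -, -, hM, -⟩
      · omega
      · exact hy
      · omega
  · -- no monogenic class at an odd level `b ≠ 2N″ + 1`
    rw [if_neg (fun h => hb' h.1)]
    haveI : IsEmpty {w : 𝒪[F] ⧸ Ideal.span ({(⟨ϖ, hϖ.mem⟩ : 𝒪[F]) ^ b} : Set 𝒪[F]) //
        ∃ y : 𝒪[F], Ideal.Quotient.mk _ y = w ∧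
          (b = 0 ∨ (b = 2 * N'' + 1 ∧ y ∈ Ideal.span ({(⟨ϖ, hϖ.mem⟩ : 𝒪[F]) ^ (N'' + 1)} : Set 𝒪[F])) ∨
            ∃ M : ℕ, 1 ≤ M ∧ M ≤ N'' ∧ b = 2 * M ∧ y ∈ Ideal.span ({(⟨ϖ, hϖ.mem⟩ : 𝒪[F]) ^ M} : Set 𝒪[F]) ∧
              y ∉ Ideal.span ({(⟨ϖ, hϖ.mem⟩ : 𝒪[F]) ^ (M + 1)} : Set 𝒪[F])) ∧
          (⟨ϖ, hϖ.mem⟩ : 𝒪[F]) ^ (N - N'') * y - c ∈ Ideal.span ({(⟨ϖ, hϖ.mem⟩ : 𝒪[F]) ^ b} : Set 𝒪[F])} := by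
      refine ⟨fun ⟨w, y, _, hl, _⟩ => ?_⟩
      rcases hl with h0 | ⟨h1, -⟩ | ⟨M, -, -, hM, -⟩
      · omega
      · exact hb' h1
      · omega
    exact Nat.card_of_isEmpty

include hϖ in
/-- **`hHeven`: at an even level `b = 2M`, `M ≥ 1`** the monogenic-level classes are the EXACT character values `y ∈ (ϖ^M) ∖ (ϖ^{M+1})` with `M ≤ N″`, counted by ★ F3-1b (C2):
with `k = N − N″` and `m = ord c`, `q^k` if `k < M` and `m = M + k`, `(q−1)q^{M−1}` if `M ≤ k` and `2M ≤ m`, else `0` — and `0` if `M > N″`.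
[cite: Neukirch1999, Ch. I §12] [cite: SerreLocalFields1979, Ch. IV §1] -/
theorem natCard_levelChars_even [Finite 𝓀[F]] [IsDiscreteValuationRing 𝒪[F]] {N N'' : ℕ} {M : ℕ} (hM1 : 1 ≤ M) (c : 𝒪[F])
    {m : ℕ} (hm : ∀ j : ℕ, c ∈ Ideal.span ({(⟨ϖ, hϖ.mem⟩ : 𝒪[F]) ^ j} : Set 𝒪[F]) ↔ j ≤ m) :
    Nat.card {w : 𝒪[F] ⧸ Ideal.span ({(⟨ϖ, hϖ.mem⟩ : 𝒪[F]) ^ (2 * M)} : Set 𝒪[F]) //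
        ∃ y : 𝒪[F], Ideal.Quotient.mk _ y = w ∧
          (2 * M = 0 ∨ (2 * M = 2 * N'' + 1 ∧ y ∈ Ideal.span ({(⟨ϖ, hϖ.mem⟩ : 𝒪[F]) ^ (N'' + 1)} : Set 𝒪[F])) ∨
            ∃ M' : ℕ, 1 ≤ M' ∧ M' ≤ N'' ∧ 2 * M = 2 * M' ∧ y ∈ Ideal.span ({(⟨ϖ, hϖ.mem⟩ : 𝒪[F]) ^ M'} : Set 𝒪[F]) ∧
              y ∉ Ideal.span ({(⟨ϖ, hϖ.mem⟩ : 𝒪[F]) ^ (M' + 1)} : Set 𝒪[F])) ∧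
          (⟨ϖ, hϖ.mem⟩ : 𝒪[F]) ^ (N - N'') * y - c ∈ Ideal.span ({(⟨ϖ, hϖ.mem⟩ : 𝒪[F]) ^ (2 * M)} : Set 𝒪[F])} =
      if M ≤ N'' then
        (if N - N'' < M ∧ m = M + (N - N'') then Nat.card 𝓀[F] ^ (N - N'')
          else if M ≤ N - N'' ∧ 2 * M ≤ m then (Nat.card 𝓀[F] - 1) * Nat.card 𝓀[F] ^ (M - 1) else 0)
      else 0 := by
  classical
  by_cases hMN : M ≤ N''
  · rw [if_pos hMN]
    -- the level predicate collapses to `y ∈ (ϖ^M) ∖ (ϖ^{M+1})`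
    rw [Nat.card_congr (Equiv.subtypeEquivRight (fun w => _) :
        _ ≃ {w : 𝒪[F] ⧸ Ideal.span ({(⟨ϖ, hϖ.mem⟩ : 𝒪[F]) ^ (2 * M)} : Set 𝒪[F]) //
          ∃ y : 𝒪[F], Ideal.Quotient.mk _ y = w ∧ y ∈ Ideal.span ({(⟨ϖ, hϖ.mem⟩ : 𝒪[F]) ^ M} : Set 𝒪[F]) ∧
            y ∉ Ideal.span ({(⟨ϖ, hϖ.mem⟩ : 𝒪[F]) ^ (M + 1)} : Set 𝒪[F]) ∧
            (⟨ϖ, hϖ.mem⟩ : 𝒪[F]) ^ (N - N'') * y - c ∈ Ideal.span ({(⟨ϖ, hϖ.mem⟩ : 𝒪[F]) ^ (2 * M)} : Set 𝒪[F])}),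
      natCard_hermitianChars_even hϖ hM1 hMN c]
    · set π : 𝒪[F] := ⟨ϖ, hϖ.mem⟩ with hπ
      by_cases hk : M ≤ N - N''
      · rw [if_pos hk, if_neg (show ¬ (N - N'' < M ∧ m = M + (N - N'')) from fun h => absurd hk (not_le.2 h.1))]
        by_cases h2 : 2 * M ≤ m
        · rw [if_pos ((hm _).2 h2), if_pos (show M ≤ N - N'' ∧ 2 * M ≤ m from ⟨hk, h2⟩)]
        · rw [if_neg (show c ∉ Ideal.span ({π ^ (2 * M)} : Set 𝒪[F]) from fun h => h2 ((hm _).1 h)),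
            if_neg (show ¬ (M ≤ N - N'' ∧ 2 * M ≤ m) from fun h => h2 h.2)]
      · rw [if_neg hk]
        have hk' : N - N'' < M := not_le.1 hk
        by_cases h2 : m = M + (N - N'')
        · have hyes : c ∈ Ideal.span ({π ^ (M + (N - N''))} : Set 𝒪[F]) ∧ c ∉ Ideal.span ({π ^ (M + (N - N'') + 1)} : Set 𝒪[F]) :=
            ⟨(hm _).2 (le_of_eq h2.symm), fun h => by have := (hm _).1 h; omega⟩
          rw [if_pos hyes, if_pos (show N - N'' < M ∧ m = M + (N - N'') from ⟨hk', h2⟩)]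
        · have hno : ¬ (c ∈ Ideal.span ({π ^ (M + (N - N''))} : Set 𝒪[F]) ∧ c ∉ Ideal.span ({π ^ (M + (N - N'') + 1)} : Set 𝒪[F])) := by
            intro h
            have h3 := (hm _).1 h.1
            have h4 : ¬ (M + (N - N'') + 1 ≤ m) := fun h' => h.2 ((hm _).2 h')
            omega
          rw [if_neg hno, if_neg (show ¬ (N - N'' < M ∧ m = M + (N - N'')) from fun h => h2 h.2),
            if_neg (show ¬ (M ≤ N - N'' ∧ 2 * M ≤ m) from fun h => hk h.1)]
    · intro w
      refine exists_congr fun y => and_congr_right fun _ => ⟨fun h => ?_, fun h => ⟨Or.inr (Or.inr ⟨M, hM1, hMN, rfl, h.1, h.2.1⟩), h.2.2⟩⟩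
      rcases h.1 with h0 | ⟨h1, -⟩ | ⟨M', -, -, hMM', hy, hy'⟩
      · omega
      · omega
      · obtain rfl : M' = M := by omega
        exact ⟨hy, hy', h.2⟩
  · -- no monogenic class at an even level above `2N″`
    rw [if_neg hMN]
    haveI : IsEmpty {w : 𝒪[F] ⧸ Ideal.span ({(⟨ϖ, hϖ.mem⟩ : 𝒪[F]) ^ (2 * M)} : Set 𝒪[F]) //
        ∃ y : 𝒪[F], Ideal.Quotient.mk _ y = w ∧
          (2 * M = 0 ∨ (2 * M = 2 * N'' + 1 ∧ y ∈ Ideal.span ({(⟨ϖ, hϖ.mem⟩ : 𝒪[F]) ^ (N'' + 1)} : Set 𝒪[F])) ∨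
            ∃ M' : ℕ, 1 ≤ M' ∧ M' ≤ N'' ∧ 2 * M = 2 * M' ∧ y ∈ Ideal.span ({(⟨ϖ, hϖ.mem⟩ : 𝒪[F]) ^ M'} : Set 𝒪[F]) ∧
              y ∉ Ideal.span ({(⟨ϖ, hϖ.mem⟩ : 𝒪[F]) ^ (M' + 1)} : Set 𝒪[F])) ∧
          (⟨ϖ, hϖ.mem⟩ : 𝒪[F]) ^ (N - N'') * y - c ∈ Ideal.span ({(⟨ϖ, hϖ.mem⟩ : 𝒪[F]) ^ (2 * M)} : Set 𝒪[F])} := by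
      refine ⟨fun ⟨w, y, _, hl, _⟩ => ?_⟩
      rcases hl with h0 | ⟨h1, -⟩ | ⟨M', -, hM'N, hMM', -, -⟩
      · omega
      · omega
      · omega
    exact Nat.card_of_isEmpty

end Literature.NumberTheory.Automorphic
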